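import Mathlib
import Summits.ValiantsHypothesis.ValiantsHypothesis.Theorems.BinomialElusiveBinomialCandidateAffinePeeling
import Literature.Combinatorics.SimpleGraph.ShortEvenClosedWalk

/-!
# Crux `BinomialElusive.BinomialCandidate` (stmt-ValiantsHypothesis-7392), line `registered` —
# helper for the stub `stub_integralPeeling`: MONOMIAL SUBSTITUTIONS (the girth case)

The registered stub `stub_integralPeeling` (integral half of the sibling crux `PeelingLemma`,
stmt-ValiantsHypothesis-7391) for a quadratic `Γ : ℂ^{m-1} → ℂ^m` and a power-series solution `p`
of `Γ(p) = (t^{N a_i} + t^{N b_i})_i`: a nonzero integer relation among the `2m` exponents of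
length `≤ ⌊log₂ m⌋²`.

This file proves it — for ARBITRARY quadratic `Γ` — when every `p_j` is a (Laurent) MONOMIAL
`c_j t^{θ_j}` (`θ_j ∈ ℤ`, poles allowed, `c_j = 0` allowed): `integralPeeling_monomialSubstitution`,
uniform in `m ≥ 64`.  This is the honest case with no cancellation at all, the case the route's
triage settled informally "by girth"; together with the affine corner
(`BinomialElusiveBinomialCandidateAffinePeeling`) and the monomial-`Γ` corner it leaves, as the open
content of the stub, substitutions `p` that are not monomial after any linear change of
coordinates.

Proof.  `Γ_i(p)` is a combination of `t^{θ_j}`, `t^{θ_j + θ_k}` and `1`, so each of the `2m`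
pairwise distinct target exponents (degenerate data are a relation of length `2`) is
`Θ(ε) = θ'_x + θ'_y` for an unordered pair `ε = s(x, y)` of vertices in `V = {0} ⊔ {1, …, m-1}`
(`θ'_0 = 0`): `2m = 2|V|` distinct edges.  The girth lemma
(`Literature.Combinatorics.SimpleGraph.exists_short_even_closed_walk`, `m ≥ 64`) gives a closed walk of even length `L ≤ ⌊log₂ m⌋²`
along these edges using some edge exactly once; its alternating edge sum, read on the targets, is
a nonzero `(u, v)` with `Σ(|u_i| + |v_i|) ≤ L` and `N Σ(u_i a_i + v_i b_i) = Σ_s (-1)^s Θ(edge_s)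
= Σ_s (-1)^s (θ'(ω_s) + θ'(ω_{s+1})) = 0` (telescoping).

Sources: Garg–Makam–Oliveira–Wigderson 2019 (arXiv:1904.04299) §9 (Prop. 9.8: monomial
substitutions, there against monomial maps); Bondy–Simonovits 1974 / the Moore bound for the girth
step.
-/

-- layout Summits/ValiantsHypothesis/ValiantsHypothesis forces the duplicated namespace component
set_option linter.dupNamespace false

namespace Summit.ValiantsHypothesis.ValiantsHypothesis.Theorems.BinomialCandidateStubs

open scoped BigOperators
open Finset

namespace MonomialSubstitution

/-! ## Monomial substitutions: every exponent of `Γ(p)` is `Σ_j d_j θ_j` for a monomial `d` of `Γ` -/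

/-- Products of monomial Laurent series. -/
theorem prod_single {ι : Type*} (s : Finset ι) (x : ι → ℤ) (r : ι → ℂ) :
    ∏ j ∈ s, HahnSeries.single (x j) (r j) = HahnSeries.single (∑ j ∈ s, x j) (∏ j ∈ s, r j) := by
  classical
  induction s using Finset.induction_on with
  | empty => simp
  | insert j s hj ih => rw [prod_insert hj, sum_insert hj, prod_insert hj, ih, HahnSeries.single_mul_single]

/-- The coefficients of `Γ(p)` for a monomial substitution `p_j = c_j t^{θ_j}`. -/
theorem coeff_aeval_single {n : ℕ} (θ : Fin n → ℤ) (c : Fin n → ℂ) (f : MvPolynomial (Fin n) ℂ)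
    (e : ℤ) :
    (MvPolynomial.aeval (fun j => HahnSeries.single (θ j) (c j)) f).coeff e =
      ∑ d ∈ f.support, if e = ∑ j, d j • θ j then f.coeff d * ∏ j, c j ^ d j else 0 := by
  classical
  conv_lhs => rw [MvPolynomial.as_sum f]
  simp only [map_sum, HahnSeries.coeff_sum]
  refine sum_congr rfl fun d _ => ?_
  rw [MvPolynomial.aeval_monomial, Finsupp.prod_fintype _ _ (fun j => pow_zero _),
    AffinePeeling.algebraMap_laurentSeries_apply]
  simp only [HahnSeries.single_pow]
  rw [prod_single, HahnSeries.single_mul_single, zero_add, HahnSeries.coeff_single]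
  by_cases h : e = ∑ j, d j • θ j <;> simp [h]

/-- A nonzero coefficient of `Γ(p)` sits at an exponent `Σ_j d_j θ_j`, `d` a monomial of `Γ`. -/
theorem exists_monomial_of_coeff_ne_zero {n : ℕ} (θ : Fin n → ℤ) (c : Fin n → ℂ)
    (f : MvPolynomial (Fin n) ℂ) {e : ℤ}
    (he : (MvPolynomial.aeval (fun j => HahnSeries.single (θ j) (c j)) f).coeff e ≠ 0) :
    ∃ d ∈ f.support, e = ∑ j, d j • θ j := by
  rw [coeff_aeval_single] at he
  obtain ⟨d, hd, hne⟩ := exists_ne_zero_of_sum_ne_zero he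
  exact ⟨d, hd, by by_contra h; exact hne (if_neg h)⟩

/-- Monomials of degree `≤ 2`: `0`, `y_j`, or `y_j y_k` (possibly `j = k`). -/
theorem finsupp_of_degree_le_two {σ : Type*} (d : σ →₀ ℕ) (hd : (d.sum fun _ e => e) ≤ 2) :
    d = 0 ∨ (∃ j, d = Finsupp.single j 1) ∨ ∃ j k, d = Finsupp.single j 1 + Finsupp.single k 1 := by
  classical
  by_cases h0 : d = 0
  · exact Or.inl h0
  obtain ⟨j, hj⟩ := Finsupp.support_nonempty_iff.mpr h0
  have hj1 : Finsupp.single j 1 ≤ d := Finsupp.single_le_iff.mpr (Nat.one_le_iff_ne_zero.mpr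
    (Finsupp.mem_support_iff.mp hj))
  set d' := d - Finsupp.single j 1 with hd'
  have hdd : d = d' + Finsupp.single j 1 := (tsub_add_cancel_of_le hj1).symm
  have hdeg : ∀ x : σ →₀ ℕ, (x.sum fun _ e => e) = Finsupp.degree x := fun x => rfl
  have hd'1 : (d'.sum fun _ e => e) ≤ 1 := by
    rw [hdeg] at hd ⊢
    rw [hdd, map_add, Finsupp.degree_single] at hd
    omega
  rcases AffinePeeling.finsupp_eq_zero_or_single_of_degree_le_one d' hd'1 with h | ⟨k, hk⟩
  · exact Or.inr (Or.inl ⟨j, by rw [hdd, h, zero_add]⟩)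
  · exact Or.inr (Or.inr ⟨k, j, by rw [hdd, hk]⟩)

/-- For a quadratic `Γ_i` and a monomial substitution, every exponent carrying a nonzero
coefficient of `Γ_i(p)` is `θ'_x + θ'_y` for an unordered pair of vertices of
`Option (Fin n)` (`θ' none = 0`, `θ' (some j) = θ_j`). -/
theorem exists_edge_of_coeff_ne_zero {n : ℕ} (θ : Fin n → ℤ) (c : Fin n → ℂ)
    (f : MvPolynomial (Fin n) ℂ) (hf : f.totalDegree ≤ 2) {e : ℤ}
    (he : (MvPolynomial.aeval (fun j => HahnSeries.single (θ j) (c j)) f).coeff e ≠ 0) :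
    ∃ ε : Sym2 (Option (Fin n)),
      e = Sym2.lift ⟨fun x y => Option.elim x 0 θ + Option.elim y 0 θ, fun _ _ => add_comm _ _⟩ ε := by
  obtain ⟨d, hd, rfl⟩ := exists_monomial_of_coeff_ne_zero θ c f he
  rcases finsupp_of_degree_le_two d ((MvPolynomial.le_totalDegree hd).trans hf) with
    rfl | ⟨j, rfl⟩ | ⟨j, k, rfl⟩
  · exact ⟨s(none, none), by simp⟩
  · exact ⟨s(none, some j), by simp [Finsupp.single_apply]⟩
  · exact ⟨s(some j, some k), by simp [Finsupp.single_apply, add_mul, ite_mul, sum_add_distrib]⟩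

/-! ## Alternating edge sums of closed walks -/

/-- Telescoping: `Σ_{s<L} (-1)^s (φ s + φ (s+1)) = φ 0 - (-1)^L φ L`. -/
theorem alternating_sum_telescope (φ : ℕ → ℤ) (L : ℕ) :
    ∑ s ∈ range L, (-1 : ℤ) ^ s * (φ s + φ (s + 1)) = φ 0 - (-1) ^ L * φ L := by
  induction L with
  | zero => simp
  | succ L ih => rw [sum_range_succ, ih, pow_succ]; ring

end MonomialSubstitution

/-- **`stub_integralPeeling`, monomial substitutions** (uniform in `m ≥ 64`): the registered
stub's statement for ARBITRARY quadratic `Γ` under the extra hypothesis that every `p_j` is a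
Laurent monomial `c_j t^{θ_j}` (no integrality needed).  Degenerate data: a relation of length `2`;
otherwise the `2m` target exponents are `2m` distinct edges on the `m` vertices
`Option (Fin (m-1))`, and the alternating sum of a short even closed walk
(`Literature.Combinatorics.SimpleGraph.exists_short_even_closed_walk`) is the relation. -/
theorem integralPeeling_monomialSubstitution :
    ∀ m ≥ 64, ∀ (a b : Fin m → ℕ) (Γ : Fin m → MvPolynomial (Fin (m - 1)) ℂ) (N : ℕ)
      (p : Fin (m - 1) → LaurentSeries ℂ), (∀ i, (Γ i).totalDegree ≤ 2) → 0 < N →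
      (∀ j, ∃ (θ : ℤ) (c : ℂ), p j = HahnSeries.single θ c) →
      (∀ i, MvPolynomial.aeval p (Γ i) =
        HahnSeries.single ((N * a i : ℕ) : ℤ) (1 : ℂ) + HahnSeries.single ((N * b i : ℕ) : ℤ) (1 : ℂ)) →
      ∃ u v : Fin m → ℤ, (u, v) ≠ 0 ∧ ∑ i, (|u i| + |v i|) ≤ ((Nat.log 2 m ^ 2 : ℕ) : ℤ) ∧
        ∑ i, (u i * (a i : ℤ) + v i * (b i : ℤ)) = 0 := by
  intro m hm a b Γ N p hΓ hN hmono hp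
  classical
  by_cases hab : Function.Injective (Sum.elim a b)
  swap
  · exact AffinePeeling.shortRelation_of_not_injective (by omega) a b hab
  obtain ⟨hinja, hinjb, hab'⟩ := Sum.elim_injective.mp hab
  choose θ c hpj using hmono
  have hpfun : p = fun j => HahnSeries.single (θ j) (c j) := funext hpj
  -- vertices, potential `Θ`, targets `X`
  set Θ : Sym2 (Option (Fin (m - 1))) → ℤ :=
    Sym2.lift ⟨fun x y => Option.elim x 0 θ + Option.elim y 0 θ, fun _ _ => add_comm _ _⟩ with hΘ
  set X : Fin m × Bool → ℤ := fun τ => ((N * (if τ.2 then b τ.1 else a τ.1) : ℕ) : ℤ) with hX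
  -- every target exponent is an edge value
  have hedge : ∀ τ, ∃ ε, X τ = Θ ε := by
    rintro ⟨i, bb⟩
    have hcoef : ∀ cc : ℕ, (cc = a i ∨ cc = b i) →
        (MvPolynomial.aeval (fun j => HahnSeries.single (θ j) (c j)) (Γ i)).coeff ((N * cc : ℕ) : ℤ) ≠ 0 := by
      intro cc hcc
      rw [← hpfun, hp i, AffinePeeling.coeff_binomial hN]
      rcases hcc with rfl | rfl <;> simp <;> split_ifs <;> norm_num
    cases bb
    · exact MonomialSubstitution.exists_edge_of_coeff_ne_zero θ c (Γ i) (hΓ i) (hcoef (a i) (Or.inl rfl))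
    · exact MonomialSubstitution.exists_edge_of_coeff_ne_zero θ c (Γ i) (hΓ i) (hcoef (b i) (Or.inr rfl))
  choose ε hε using hedge
  -- `X` (hence `ε`) is injective: the exponents are pairwise distinct
  have hXinj : Function.Injective X := by
    rintro ⟨i, bi⟩ ⟨j, bj⟩ h
    simp only [hX, Nat.cast_inj] at h
    have h' := Nat.eq_of_mul_eq_mul_left hN h
    cases bi <;> cases bj <;> simp only [Bool.false_eq_true, if_false, if_true] at h'
    · rw [hinja h']
    · exact absurd h' (hab' i j)
    · exact absurd h'.symm (hab' j i)
    · rw [hinjb h']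
  have hεinj : Function.Injective ε := fun τ τ' h => hXinj (by rw [hε τ, hε τ', h])
  -- the girth lemma on `E = image ε`
  have hm1 : 1 ≤ m := by omega
  haveI : Nonempty (Option (Fin (m - 1))) := ⟨none⟩
  have hcardV : Fintype.card (Option (Fin (m - 1))) = m := by
    rw [Fintype.card_option, Fintype.card_fin]; omega
  set E : Finset (Sym2 (Option (Fin (m - 1)))) := univ.image ε with hE
  have hEcard : #E = 2 * m := by
    rw [hE, card_image_of_injective _ hεinj, card_univ, Fintype.card_prod, Fintype.card_fin,
      Fintype.card_bool, mul_comm]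
  obtain ⟨L, ω, s₀, hL, hLeven, hs₀, hclosed, hωE, honce⟩ :=
    Literature.Combinatorics.SimpleGraph.exists_short_even_closed_walk E hm hcardV.le
      (by rw [hEcard, hcardV])
  -- the alternating edge sum, read on the targets
  set w : Fin m × Bool → ℤ := fun τ =>
    ∑ s ∈ range L, if s(ω s, ω (s + 1)) = ε τ then (-1 : ℤ) ^ s else 0 with hw
  -- each step's edge is `ε τ` for exactly one target `τ`
  have hfib : ∀ s < L, #(univ.filter fun τ => ε τ = s(ω s, ω (s + 1))) = 1 := by
    intro s hs
    obtain ⟨τ, -, hτ⟩ := mem_image.mp (hωE s hs)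
    rw [card_eq_one]
    refine ⟨τ, eq_singleton_iff_unique_mem.mpr ⟨mem_filter.mpr ⟨mem_univ _, hτ⟩, fun τ' hτ' => ?_⟩⟩
    exact hεinj ((mem_filter.mp hτ').2.trans hτ.symm)
  have hfib' : ∀ s < L, ∀ g : Fin m × Bool → ℤ, (∀ τ τ', ε τ = s(ω s, ω (s + 1)) →
      ε τ' = s(ω s, ω (s + 1)) → g τ = g τ') →
      ∑ τ, (if s(ω s, ω (s + 1)) = ε τ then g τ else 0) =
        ∑ τ ∈ univ.filter (fun τ => ε τ = s(ω s, ω (s + 1))), g τ := by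
    intro s _ g _
    rw [sum_filter]
    exact sum_congr rfl fun τ _ => by simp only [eq_comm]
  refine ⟨fun i => w (i, false), fun i => w (i, true), ?_, ?_, ?_⟩
  · -- nonzero: the target of the once-traversed edge has coefficient `± 1`
    obtain ⟨τ₀, -, hτ₀⟩ := mem_image.mp (hωE s₀ hs₀)
    have hw0 : w τ₀ = (-1) ^ s₀ := by
      simp only [hw]
      rw [sum_eq_single s₀]
      · rw [if_pos hτ₀.symm]
      · intro s hs hss
        rw [if_neg]
        intro h
        exact hss (honce s (mem_range.mp hs) (h.trans hτ₀))
      · intro h; exact absurd (mem_range.mpr hs₀) h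
    have hne : w τ₀ ≠ 0 := by rw [hw0]; exact pow_ne_zero _ (by norm_num)
    intro h0
    obtain ⟨i, bb⟩ := τ₀
    cases bb
    · exact hne (by simpa using congr_fun (congr_arg Prod.fst h0) i)
    · exact hne (by simpa using congr_fun (congr_arg Prod.snd h0) i)
  · -- length `≤ L ≤ ⌊log₂ m⌋²`
    have hlen : ∑ τ, |w τ| ≤ (L : ℤ) := by
      calc ∑ τ, |w τ| ≤ ∑ τ, ∑ s ∈ range L, (if s(ω s, ω (s + 1)) = ε τ then (1 : ℤ) else 0) := by
            refine sum_le_sum fun τ _ => (abs_sum_le_sum_abs _ _).trans (sum_le_sum fun s _ => ?_)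
            split_ifs <;> simp
        _ = ∑ s ∈ range L, ∑ τ, (if s(ω s, ω (s + 1)) = ε τ then (1 : ℤ) else 0) := sum_comm
        _ = ∑ s ∈ range L, (1 : ℤ) := by
            refine sum_congr rfl fun s hs => ?_
            rw [hfib' s (mem_range.mp hs) (fun _ => 1) (fun _ _ _ _ => rfl), sum_const,
              hfib s (mem_range.mp hs)]
            simp
        _ = L := by simp
    calc ∑ i, (|w (i, false)| + |w (i, true)|) = ∑ τ, |w τ| := by
          rw [Fintype.sum_prod_type]
          exact sum_congr rfl fun i _ => by simp [add_comm]
      _ ≤ L := hlen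
      _ ≤ ((Nat.log 2 m ^ 2 : ℕ) : ℤ) := by exact_mod_cast hL
  · -- the relation: `N Σ (u a + v b) = Σ_τ w τ X τ = Σ_s (-1)^s Θ(edge s) = 0`
    have hNX : ∀ i, (w (i, false) * (a i : ℤ) + w (i, true) * (b i : ℤ)) * N =
        w (i, false) * X (i, false) + w (i, true) * X (i, true) := fun i => by
      simp only [hX, Bool.false_eq_true, if_false, if_true, Nat.cast_mul]; ring
    have hsumX : ∑ τ, w τ * X τ = ∑ s ∈ range L, (-1 : ℤ) ^ s * Θ (s(ω s, ω (s + 1))) := by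
      calc ∑ τ, w τ * X τ
          = ∑ τ, ∑ s ∈ range L, (if s(ω s, ω (s + 1)) = ε τ then (-1 : ℤ) ^ s * Θ (ε τ) else 0) := by
            refine sum_congr rfl fun τ _ => ?_
            rw [hw, sum_mul]
            exact sum_congr rfl fun s _ => by rw [ite_mul, zero_mul, hε τ]
        _ = ∑ s ∈ range L, ∑ τ, (if s(ω s, ω (s + 1)) = ε τ then (-1 : ℤ) ^ s * Θ (ε τ) else 0) :=
            sum_comm
        _ = ∑ s ∈ range L, (-1 : ℤ) ^ s * Θ (s(ω s, ω (s + 1))) := by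
            refine sum_congr rfl fun s hs => ?_
            rw [hfib' s (mem_range.mp hs) (fun τ => (-1 : ℤ) ^ s * Θ (ε τ))
              (fun τ τ' h h' => by rw [h, h'])]
            rw [sum_congr rfl fun τ hτ => by rw [(mem_filter.mp hτ).2], sum_const,
              hfib s (mem_range.mp hs)]
            simp
    have htel : ∑ s ∈ range L, (-1 : ℤ) ^ s * Θ (s(ω s, ω (s + 1))) = 0 := by
      have : ∀ s, Θ (s(ω s, ω (s + 1))) =
          (fun s => Option.elim (ω s) 0 θ) s + (fun s => Option.elim (ω s) 0 θ) (s + 1) := fun s => by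
        simp [hΘ]
      simp only [this]
      rw [MonomialSubstitution.alternating_sum_telescope, hclosed, Even.neg_one_pow hLeven, one_mul,
        sub_self]
    have hN0 : (N : ℤ) ≠ 0 := by exact_mod_cast hN.ne'
    have key : (∑ i, (w (i, false) * (a i : ℤ) + w (i, true) * (b i : ℤ))) * N = 0 := by
      rw [sum_mul, sum_congr rfl fun i _ => hNX i]
      have : ∑ i, (w (i, false) * X (i, false) + w (i, true) * X (i, true)) = ∑ τ, w τ * X τ := by
        rw [Fintype.sum_prod_type]
        exact sum_congr rfl fun i _ => by simp [add_comm]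
      rw [this, hsumX, htel]
    exact (mul_eq_zero.mp key).resolve_right hN0

end Summit.ValiantsHypothesis.ValiantsHypothesis.Theorems.BinomialCandidateStubs
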